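import Literature.AnabelianGeometry.EtaleTheta.FrobenioidThetaDivisorSupportIntersection
import Literature.AnabelianGeometry.EtaleTheta.FrobenioidThetaDivisorChainCount

/-!
# [EtTh] §5, Proposition 5.3 (v): counting the cusps of a cuspidal divisor linearly equivalent to `m·(n_p + n_q)` (GAP-LEDGER G-L2d4-2, part 2)

Mochizuki, *The étale theta function …*, Publ. RIMS **45** (2009)
[cite: MochizukiEtTh2009, Prop 5.3 proof p.326–327 (PDF pp.100–101); §1 p.240 (PDF p.14)].
Seat abc-iut-L6-d1 (gen 3); proof-only, over `DivisorSupportData'` (`FrobenioidThetaDivisorSupportR.lean`), the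
toolkit `…Orders.lean`, `…Intersection.lean` and the `ℤ`-combinatorics `FrobenioidThetaDivisorChainCount.lean`.

For two distinct components `P ≠ Q` of the chain and `m ≥ 1`, let `V = m·(gen P + gen Q) ∈ Φ(A_⊚)^gp` ("`a + b`"
of p.326 with "`a ∈ 𝔭`, `b ∈ 𝔮` correspond[ing] via the natural isomorphisms of (ii)", i.e. of equal multiplicity).
This file proves, from the intersection theory of the chain (`PrincipalIffDegreeZero`, [EtTh] §1 p.240):
* `degOn_pair` — the degree of `V` on the component labelled `i` is `m` times the chain degree of
  `FrobenioidThetaDivisorChainCount` at `(p, q) = (label P, label Q)`; hence the set of components on which `V` has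
  non-zero degree is the preimage of the six labels `{p−1, p, p+1, q−1, q, q+1}` (`setOf_degOn_pair_ne_zero`) and has
  `ncard` = the number of distinct such labels (`ncard_setOf_degOn_pair_ne_zero`);
* `ncard_le_of_cuspidal_linEquiv` — LOWER BOUND: a cuspidal element of finite support linearly equivalent to `V`
  has a cusp of its support over every component on which `V` has non-zero degree ("principal ⇒ degrees vanish");
* `exists_cuspidal_linEquiv_pair` — EXISTENCE: choosing one cusp over each such component (the surjection of (iv))
  with multiplicity the degree gives a cuspidal element of finite support, linearly equivalent to `V` ("degrees
  vanish ⇒ principal"), whose support has exactly that many cusps.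
The assembly into `AdjacencyCriterion'` ("4 versus 5 or 6") is `FrobenioidThetaDivisorSupportAdjacency.lean`.
HONEST FRAMING: implications between predicates on OUR typed data under the explicit binder
`PrincipalIffDegreeZero`; no side taken on anything downstream; typed ≠ proved for the genuine curve. -/

namespace Literature.AnabelianGeometry.EtaleTheta

open CategoryTheory
open Literature.AlgebraicGeometry.Frobenioids

universe w v v' u u'

namespace FrobenioidThetaDivisors

open scoped Classical

variable {C : Type u} [Category.{v} C] {D : Type u'} [Category.{v'} D] {𝔉 : ThetaFrobenioid.{w} C D}
variable {𝔓 : DivisorPrimeData 𝔉}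

/-- `𝔪 = 𝔫⁺` read on labels. [cite: MochizukiEtTh2009, §1 p.239–240 (PDF pp.13–14)] -/
theorem eq_ncspShift_iff (t : ℤ) (𝔪 𝔫 : {p : Primes 𝔉.PhiAcirc // ¬ 𝔓.IsCuspidal p}) :
    𝔪 = ncspShift 𝔓 t 𝔫 ↔ 𝔓.ncspEquivZ 𝔪 = 𝔓.ncspEquivZ 𝔫 + t := by
  rw [← 𝔓.ncspEquivZ.apply_eq_iff_eq, ncspEquivZ_ncspShift]

/-- Equality of components read on labels. [cite: MochizukiEtTh2009, §1 p.239–240 (PDF pp.13–14)] -/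
theorem ncsp_eq_iff (𝔪 𝔫 : {p : Primes 𝔉.PhiAcirc // ¬ 𝔓.IsCuspidal p}) :
    𝔪 = 𝔫 ↔ 𝔓.ncspEquivZ 𝔪 = 𝔓.ncspEquivZ 𝔫 :=
  𝔓.ncspEquivZ.apply_eq_iff_eq.symm

namespace DivisorSupportData'

variable (𝔖 : DivisorSupportData' 𝔓)

/-! ### Powers -/

/-- The support of a power. [cite: MochizukiEtTh2009, Prop 5.3 proof p.326 (PDF p.100)] -/
theorem supp_pow_subset (x : Algebra.GrothendieckGroup 𝔉.PhiAcirc) (n : ℕ) : 𝔖.supp (x ^ n) ⊆ 𝔖.supp x := by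
  intro 𝔭 h
  rw [mem_supp_iff, ord_pow] at h
  rw [mem_supp_iff]
  exact fun h' => h (by rw [h', mul_zero])

/-- `degOn` of a power of an element of finite support. [cite: MochizukiEtTh2009, §1 p.240 (PDF p.14)] -/
theorem degOn_pow (𝔪 : {p : Primes 𝔉.PhiAcirc // ¬ 𝔓.IsCuspidal p}) {x : Algebra.GrothendieckGroup 𝔉.PhiAcirc}
    (hx : (𝔖.supp x).Finite) (n : ℕ) : 𝔖.degOn 𝔪 (x ^ n) = n * 𝔖.degOn 𝔪 x := by
  induction n with
  | zero =>
    rw [pow_zero, Nat.cast_zero, zero_mul, degOn_eq, ord_one, ord_one, ord_one]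
    simp only [ord_one, finsum_zero, mul_zero, sub_self, add_zero]
  | succ n ih =>
    rw [pow_succ, 𝔖.degOn_mul 𝔪 (hx.subset (𝔖.supp_pow_subset x n)) hx, ih]
    push_cast; ring

/-- `ord` of a finite product. [cite: MochizukiEtTh2009, Prop 5.3 proof p.326 (PDF p.100)] -/
theorem ord_prod {ι : Type*} (s : Finset ι) (f : ι → Algebra.GrothendieckGroup 𝔉.PhiAcirc) (𝔭 : Primes 𝔉.PhiAcirc) :
    𝔖.ord 𝔭 (∏ i ∈ s, f i) = ∑ i ∈ s, 𝔖.ord 𝔭 (f i) := by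
  induction s using Finset.induction_on with
  | empty => rw [Finset.prod_empty, Finset.sum_empty, ord_one]
  | insert i s hi ih => rw [Finset.prod_insert hi, Finset.sum_insert hi, ord_mul, ih]

/-! ### The degree of `m·(gen P + gen Q)` -/

section Pair

variable (P Q : {p : Primes 𝔉.PhiAcirc // ¬ 𝔓.IsCuspidal p}) (m : ℕ)

/-- **The degree of `V = m·(gen P + gen Q)` on the component `𝔪`** is `m` times the chain degree at the label of
`𝔪`: `m·([i = p+1] − 2[i = p] + [i = p−1] + [i = q+1] − 2[i = q] + [i = q−1])`, `i, p, q` the labels of `𝔪, P, Q`.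
[cite: MochizukiEtTh2009, §1 p.240 (PDF p.14); Prop 5.3 proof p.326–327 (PDF pp.100–101)] -/
theorem degOn_pair (𝔪 : {p : Primes 𝔉.PhiAcirc // ¬ 𝔓.IsCuspidal p}) :
    𝔖.degOn 𝔪 (Algebra.GrothendieckGroup.of (𝔖.gen P.1) ^ m * Algebra.GrothendieckGroup.of (𝔖.gen Q.1) ^ m) =
      m * ((if 𝔓.ncspEquivZ 𝔪 = 𝔓.ncspEquivZ P + 1 then (1 : ℚ) else 0) -
          2 * (if 𝔓.ncspEquivZ 𝔪 = 𝔓.ncspEquivZ P then 1 else 0) +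
          (if 𝔓.ncspEquivZ 𝔪 = 𝔓.ncspEquivZ P - 1 then 1 else 0) +
        ((if 𝔓.ncspEquivZ 𝔪 = 𝔓.ncspEquivZ Q + 1 then (1 : ℚ) else 0) -
          2 * (if 𝔓.ncspEquivZ 𝔪 = 𝔓.ncspEquivZ Q then 1 else 0) +
          (if 𝔓.ncspEquivZ 𝔪 = 𝔓.ncspEquivZ Q - 1 then 1 else 0))) := by
  rw [𝔖.degOn_mul 𝔪 ((𝔖.supp_gen_finite P.1).subset (𝔖.supp_pow_subset _ m))
      ((𝔖.supp_gen_finite Q.1).subset (𝔖.supp_pow_subset _ m)),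
    𝔖.degOn_pow 𝔪 (𝔖.supp_gen_finite P.1), 𝔖.degOn_pow 𝔪 (𝔖.supp_gen_finite Q.1),
    degOn_gen_ncsp, degOn_gen_ncsp]
  simp only [ncsp_eq_iff, ncspEquivZ_ncspShift, sub_eq_add_neg]
  ring

/-- **The components on which `V = m·(gen P + gen Q)` (`P ≠ Q`, `m ≥ 1`) has non-zero degree are exactly those
labelled `p−1, p, p+1, q−1, q, q+1`.**  [cite: MochizukiEtTh2009, Prop 5.3 proof p.327 (PDF p.101)] -/
theorem setOf_degOn_pair_ne_zero (hPQ : P ≠ Q) (hm : 0 < m) :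
    {𝔪 | 𝔖.degOn 𝔪 (Algebra.GrothendieckGroup.of (𝔖.gen P.1) ^ m *
        Algebra.GrothendieckGroup.of (𝔖.gen Q.1) ^ m) ≠ 0} =
      𝔓.ncspEquivZ ⁻¹' ↑({𝔓.ncspEquivZ P - 1, 𝔓.ncspEquivZ P, 𝔓.ncspEquivZ P + 1,
        𝔓.ncspEquivZ Q - 1, 𝔓.ncspEquivZ Q, 𝔓.ncspEquivZ Q + 1} : Finset ℤ) := by
  have hpq : 𝔓.ncspEquivZ P ≠ 𝔓.ncspEquivZ Q := fun h => hPQ (𝔓.ncspEquivZ.injective h)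
  ext 𝔪
  rw [Set.mem_setOf_eq, Set.mem_preimage, Finset.mem_coe, degOn_pair, mul_ne_zero_iff,
    chainDeg_ne_zero_iff hpq]
  simp only [ne_eq, Nat.cast_eq_zero, hm.ne', not_false_eq_true, true_and]

/-- That set of components is finite. [cite: MochizukiEtTh2009, Prop 5.3 proof p.327 (PDF p.101)] -/
theorem setOf_degOn_pair_ne_zero_finite (hPQ : P ≠ Q) (hm : 0 < m) :
    {𝔪 | 𝔖.degOn 𝔪 (Algebra.GrothendieckGroup.of (𝔖.gen P.1) ^ m *
        Algebra.GrothendieckGroup.of (𝔖.gen Q.1) ^ m) ≠ 0}.Finite := by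
  rw [𝔖.setOf_degOn_pair_ne_zero P Q m hPQ hm]
  exact (Finset.finite_toSet _).preimage 𝔓.ncspEquivZ.injective.injOn

/-- **… and their number is the number of distinct labels among the six.**
[cite: MochizukiEtTh2009, Prop 5.3 proof p.327 (PDF p.101)] -/
theorem ncard_setOf_degOn_pair_ne_zero (hPQ : P ≠ Q) (hm : 0 < m) :
    {𝔪 | 𝔖.degOn 𝔪 (Algebra.GrothendieckGroup.of (𝔖.gen P.1) ^ m *
        Algebra.GrothendieckGroup.of (𝔖.gen Q.1) ^ m) ≠ 0}.ncard =
      ({𝔓.ncspEquivZ P - 1, 𝔓.ncspEquivZ P, 𝔓.ncspEquivZ P + 1,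
        𝔓.ncspEquivZ Q - 1, 𝔓.ncspEquivZ Q, 𝔓.ncspEquivZ Q + 1} : Finset ℤ).card := by
  rw [𝔖.setOf_degOn_pair_ne_zero P Q m hPQ hm,
    Set.ncard_preimage_of_injective_subset_range 𝔓.ncspEquivZ.injective
      (by rw [𝔓.ncspEquivZ.range_eq_univ]; exact Set.subset_univ _),
    Set.ncard_coe_finset]

end Pair

/-! ### Lower bound: a cusp over every component of non-zero degree -/

/-- **LOWER BOUND.**  If principal elements have degree `0` on every component, then a cuspidal element `c` of
finite support linearly equivalent to an element `V` of finite support has, over every component on which `V`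
has non-zero degree, a cusp of its own support (the degrees of `c` and `V` agree, and the degree of a cuspidal
element on a component is the sum of its orders at the cusps over it); in particular
`#{components of non-zero V-degree} ≤ #supp c`.  [cite: MochizukiEtTh2009, Prop 5.3 proof p.326–327 (PDF pp.100–101)] -/
theorem ncard_le_of_cuspidal_linEquiv
    (hP : ∀ x : Algebra.GrothendieckGroup 𝔉.PhiAcirc, 𝔖.IsPrincipal x → ∀ 𝔪, 𝔖.degOn 𝔪 x = 0)
    {V c : Algebra.GrothendieckGroup 𝔉.PhiAcirc} (hV : (𝔖.supp V).Finite)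
    (hc : 𝔖.IsCuspidalGp c) (hcfin : (𝔖.supp c).Finite) (hlin : 𝔖.LinEquiv c V) :
    {𝔪 | 𝔖.degOn 𝔪 V ≠ 0}.ncard ≤ (𝔖.supp c).ncard := by
  -- over each component of non-zero `V`-degree, `c` has a cusp in its support
  have key : ∀ 𝔪 : {p : Primes 𝔉.PhiAcirc // ¬ 𝔓.IsCuspidal p}, 𝔖.degOn 𝔪 V ≠ 0 →
      ∃ 𝔠 : {p : Primes 𝔉.PhiAcirc // 𝔓.IsCuspidal p}, 𝔓.cspToNcsp 𝔠 = 𝔪 ∧ 𝔠.1 ∈ 𝔖.supp c := by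
    intro 𝔪 h𝔪
    apply 𝔖.exists_cusp_of_cuspSum_ne_zero 𝔪
    have h0 := hP _ ((𝔖.isPrincipal_iff_mem _).mpr hlin) 𝔪
    rw [𝔖.degOn_mul 𝔪 hcfin (by rwa [supp_inv]), degOn_inv, degOn_eq,
      𝔖.vert_eq_zero_of_isCuspidalGp 𝔪 hc, zero_add] at h0
    intro h; rw [h] at h0; exact h𝔪 (by linarith)
  rcases Set.eq_empty_or_nonempty {𝔪 | 𝔖.degOn 𝔪 V ≠ 0} with hT | ⟨𝔪₀, -⟩
  · rw [hT, Set.ncard_empty]; exact Nat.zero_le _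
  -- the component under a prime (junk value `𝔪₀` on non-cuspidal primes)
  let F : Primes 𝔉.PhiAcirc → {p : Primes 𝔉.PhiAcirc // ¬ 𝔓.IsCuspidal p} := fun 𝔯 =>
    if h : 𝔓.IsCuspidal 𝔯 then 𝔓.cspToNcsp ⟨𝔯, h⟩ else 𝔪₀
  have hsub : {𝔪 | 𝔖.degOn 𝔪 V ≠ 0} ⊆ F '' 𝔖.supp c := by
    intro 𝔪 h𝔪
    obtain ⟨𝔠, h𝔠, h𝔠c⟩ := key 𝔪 h𝔪
    refine ⟨𝔠.1, h𝔠c, ?_⟩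
    simp only [F, dif_pos 𝔠.2]
    exact h𝔠
  exact (Set.ncard_le_ncard hsub (hcfin.image F)).trans (Set.ncard_image_le hcfin)

/-! ### Existence: one cusp over each component of non-zero degree -/

/-- **EXISTENCE.**  Under `PrincipalIffDegreeZero`, for `V = m·(gen P + gen Q)` (`P ≠ Q`, `m ≥ 1`) there is a
cuspidal element of finite support, linearly equivalent to `V`, whose support has exactly
`#{components of non-zero V-degree}` cusps: one chosen cusp over each such component (the surjection of (iv)),
with multiplicity the (integral) degree.  [cite: MochizukiEtTh2009, Prop 5.3 proof p.326–327 (PDF pp.100–101); §1 p.240 (PDF p.14)] -/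
theorem exists_cuspidal_linEquiv_pair (hI : 𝔖.PrincipalIffDegreeZero)
    (P Q : {p : Primes 𝔉.PhiAcirc // ¬ 𝔓.IsCuspidal p}) (hPQ : P ≠ Q) (m : ℕ) (hm : 0 < m) :
    ∃ c₀ : Algebra.GrothendieckGroup 𝔉.PhiAcirc, 𝔖.IsCuspidalGp c₀ ∧ (𝔖.supp c₀).Finite ∧
      𝔖.LinEquiv c₀ (Algebra.GrothendieckGroup.of (𝔖.gen P.1) ^ m *
        Algebra.GrothendieckGroup.of (𝔖.gen Q.1) ^ m) ∧
      (𝔖.supp c₀).ncard = {𝔪 | 𝔖.degOn 𝔪 (Algebra.GrothendieckGroup.of (𝔖.gen P.1) ^ m *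
        Algebra.GrothendieckGroup.of (𝔖.gen Q.1) ^ m) ≠ 0}.ncard := by
  set V := Algebra.GrothendieckGroup.of (𝔖.gen P.1) ^ m * Algebra.GrothendieckGroup.of (𝔖.gen Q.1) ^ m
    with hVdef
  -- the integral degree vector
  obtain ⟨z, hzdeg⟩ : ∃ z : {p : Primes 𝔉.PhiAcirc // ¬ 𝔓.IsCuspidal p} → ℤ, ∀ 𝔪, (z 𝔪 : ℚ) = 𝔖.degOn 𝔪 V :=
    ⟨fun 𝔪 => m * ((if 𝔓.ncspEquivZ 𝔪 = 𝔓.ncspEquivZ P + 1 then (1 : ℤ) else 0) -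
          2 * (if 𝔓.ncspEquivZ 𝔪 = 𝔓.ncspEquivZ P then 1 else 0) +
          (if 𝔓.ncspEquivZ 𝔪 = 𝔓.ncspEquivZ P - 1 then 1 else 0) +
        ((if 𝔓.ncspEquivZ 𝔪 = 𝔓.ncspEquivZ Q + 1 then (1 : ℤ) else 0) -
          2 * (if 𝔓.ncspEquivZ 𝔪 = 𝔓.ncspEquivZ Q then 1 else 0) +
          (if 𝔓.ncspEquivZ 𝔪 = 𝔓.ncspEquivZ Q - 1 then 1 else 0))),
      fun 𝔪 => by rw [hVdef, degOn_pair]; push_cast; ring⟩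
  set T := {𝔪 | 𝔖.degOn 𝔪 V ≠ 0} with hT
  have hTfin : T.Finite := 𝔖.setOf_degOn_pair_ne_zero_finite P Q m hPQ hm
  -- one cusp over each component
  choose d hd using 𝔓.cspToNcsp_surjective
  have hdinj : ∀ 𝔪 𝔪' : {p : Primes 𝔉.PhiAcirc // ¬ 𝔓.IsCuspidal p}, (d 𝔪).1 = (d 𝔪').1 → 𝔪 = 𝔪' := by
    intro 𝔪 𝔪' h
    have : d 𝔪 = d 𝔪' := Subtype.ext h
    rw [← hd 𝔪, ← hd 𝔪', this]
  -- the element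
  set c₀ := ∏ 𝔪 ∈ hTfin.toFinset, Algebra.GrothendieckGroup.of (𝔖.gen (d 𝔪).1) ^ z 𝔪 with hc₀
  -- its orders
  have hord : ∀ 𝔯 : Primes 𝔉.PhiAcirc,
      𝔖.ord 𝔯 c₀ = ∑ 𝔪 ∈ hTfin.toFinset, (z 𝔪 : ℚ) * (if 𝔯 = (d 𝔪).1 then 1 else 0) := by
    intro 𝔯
    rw [hc₀, ord_prod]
    refine Finset.sum_congr rfl fun 𝔪 _ => ?_
    rw [ord_zpow, ord_gen]
  have hord_d : ∀ 𝔪₀ : {p : Primes 𝔉.PhiAcirc // ¬ 𝔓.IsCuspidal p}, 𝔪₀ ∈ T →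
      𝔖.ord (d 𝔪₀).1 c₀ = z 𝔪₀ := by
    intro 𝔪₀ h𝔪₀
    rw [hord, Finset.sum_eq_single 𝔪₀]
    · rw [if_pos rfl, mul_one]
    · intro 𝔪 _ hne
      rw [if_neg (fun h => hne (hdinj _ _ h.symm)), mul_zero]
    · intro h; exact absurd (hTfin.mem_toFinset.mpr h𝔪₀) h
  have hord_other : ∀ 𝔯 : Primes 𝔉.PhiAcirc, (∀ 𝔪 ∈ T, 𝔯 ≠ (d 𝔪).1) → 𝔖.ord 𝔯 c₀ = 0 := by
    intro 𝔯 h𝔯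
    rw [hord]
    refine Finset.sum_eq_zero fun 𝔪 h𝔪 => ?_
    rw [if_neg (h𝔯 𝔪 (hTfin.mem_toFinset.mp h𝔪)), mul_zero]
  -- its support
  have hsupp : 𝔖.supp c₀ = (fun 𝔪 => (d 𝔪).1) '' T := by
    ext 𝔯
    rw [mem_supp_iff, Set.mem_image]
    constructor
    · intro h
      by_contra h'
      push Not at h'
      exact h (hord_other 𝔯 fun 𝔪 h𝔪 h𝔯 => h' 𝔪 h𝔪 h𝔯.symm)
    · rintro ⟨𝔪, h𝔪, rfl⟩
      rw [hord_d 𝔪 h𝔪]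
      have : 𝔖.degOn 𝔪 V ≠ 0 := h𝔪
      rwa [← hzdeg] at this
  have hfin : (𝔖.supp c₀).Finite := by rw [hsupp]; exact hTfin.image _
  have hcusp : 𝔖.IsCuspidalGp c₀ := by
    intro 𝔯 h𝔯
    change 𝔯 ∈ 𝔖.supp c₀ at h𝔯
    rw [hsupp] at h𝔯
    obtain ⟨𝔪, -, rfl⟩ := h𝔯
    exact (d 𝔪).2
  -- its degrees: `degOn 𝔪' c₀ = z 𝔪' = degOn 𝔪' V`
  have hdeg : ∀ 𝔪' : {p : Primes 𝔉.PhiAcirc // ¬ 𝔓.IsCuspidal p}, 𝔖.degOn 𝔪' c₀ = 𝔖.degOn 𝔪' V := by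
    intro 𝔪'
    rw [degOn_eq, 𝔖.vert_eq_zero_of_isCuspidalGp 𝔪' hcusp, zero_add,
      finsum_eq_single _ (⟨d 𝔪', hd 𝔪'⟩ :
        {𝔠 : {p : Primes 𝔉.PhiAcirc // 𝔓.IsCuspidal p} // 𝔓.cspToNcsp 𝔠 = 𝔪'})]
    · -- the value at the chosen cusp over `𝔪'`
      change 𝔖.ord (d 𝔪').1 c₀ = _
      by_cases h𝔪' : 𝔪' ∈ T
      · rw [hord_d 𝔪' h𝔪', hzdeg]
      · have h0 : 𝔖.degOn 𝔪' V = 0 := by by_contra h; exact h𝔪' h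
        rw [h0]
        apply hord_other
        intro 𝔪 h𝔪 h
        exact h𝔪' (by rw [hdinj _ _ h]; exact h𝔪)
    · -- every other cusp over `𝔪'` has order `0`
      intro 𝔠 h𝔠
      apply hord_other
      intro 𝔪 h𝔪 h
      have h1 : 𝔠.1 = d 𝔪 := Subtype.ext h
      have h2 : 𝔪 = 𝔪' := by rw [← hd 𝔪, ← h1]; exact 𝔠.2
      subst h2
      exact h𝔠 (Subtype.ext h1)
  have hVfin : (𝔖.supp V).Finite :=
    ((((𝔖.supp_gen_finite P.1).subset (𝔖.supp_pow_subset _ m))).union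
      ((𝔖.supp_gen_finite Q.1).subset (𝔖.supp_pow_subset _ m))).subset (𝔖.supp_mul_subset _ _)
  refine ⟨c₀, hcusp, hfin, ?_, ?_⟩
  · -- linearly equivalent to `V`: all degrees of `c₀ · V⁻¹` vanish
    change c₀ * V⁻¹ ∈ 𝔖.principal
    rw [← isPrincipal_iff_mem]
    refine (hI _).mpr fun 𝔪' => ?_
    rw [𝔖.degOn_mul 𝔪' hfin (by rwa [supp_inv]), degOn_inv, hdeg, add_neg_cancel]
  · rw [hsupp, Set.ncard_image_of_injective _ fun a b h => hdinj a b h]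

end DivisorSupportData'

end FrobenioidThetaDivisors

end Literature.AnabelianGeometry.EtaleTheta
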